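import Summits.QuantumFields.BalabanUV.Beta.D1BFx.KCombineCovLegs
import Summits.QuantumFields.BalabanUV.Beta.D1BFx.GaugeJetLocal

/-!
# `BalabanUV.Beta.D1BFx.KCombineCovCombLeg` — road «BF-x» for binder row D1, slot (K), (K) CLOSURE PLAN (R1-L) v0.2 §7 row **(A1′-τ) «COMB-FP LEG» ∕
# «COMB TRACE»** of `KCombineCov` (p251661): the THIRD leg letter of the covariant organisation at the rooted gauge basis `Ŵ₀ = What0` — the comb-FP
# leg is the IDENTITY (`τ_T·Ŵ₀ = 1`, `KCombineCov` §3′), its `ℤ⁴` leg is the identity site kernel `GaugeJetLocal.idK1`, whose periodisation is `1`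
# and whose socket is TA3 `TorusTraceTadpole.tendsto_hessT_hessKer` at a trivially decaying, translation-invariant leg (owner d1-p2-g9 list,
# journal 2026-08-21 l.28128; ρ-g9-11 «(A1′-τ) yours after if free»)

HONEST FRAMING (cell contract, verbatim): «discharging `BetaPertH` makes Bałaban's UV stability UNCONDITIONAL — a real constructive-QFT
result; it is NOT the continuum limit and NOT the Clay problem.»  HONEST DEPENDENCY (verbatim): «continuum YM on T⁴ ⇐ BetaPertH ∧ nine
spine estimates (0/9 proved); BetaPertH ⇐ (D1) ∧ (D4) ∧ CAP+tail; G-an2-4 gates asym, D1 and NE2/3/4.»  THIS MODULE DISCHARGES NOTHING of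
D1 ∕ BetaPertH: [folklore] finite matrix algebra (trace cyclicity) and compositions BY NAME — the owner's `GaugeJetLocal.idK1`, this lineage's
`FibredPeriodisation.periodiseF_kdeltaF_matrix`, `PeriodicArrays`, `TorusTraceTadpole.tendsto_hessT_hessKer`, `TorusGhostLegs.tendsto_mul_period`,
`TorusGaugeBasisKernel.Nhat_mul_tauT`, `KCombineCov.hessT_one_leg`, `KCombineCovLegs` (`hessT_submatrix_fst`, `tendsto_hessT_GPhi`) and
`KCombineCov.hessKer_transfer_road_cov`.  No `def`, no `def … : Prop`, nothing cited, 0 sorry.  NOT summit progress; NOT BetaPertH, NOT continuum, NOT Clay.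

ABSOLUTE RULE (cell, verbatim): «No internally-minted statement may enter as a cited fact. Every hypothesis is either kernel-proved in this
package or a verbatim quotation of a PUBLISHED theorem with page reference. The manuscript(s) under audit are NOT citable for their own
disputed steps — they are the thing under adjudication; programme-internal (2001/route/tribunal) claims are never citable.»

CONTENT (all [folklore]; `s = (m+1)·p`, `N̂ = Nhat r (m+1) p`, `τ_T = tauT (toSite r) (m+1) p`, `Xᶠ := X.submatrix Prod.fst Prod.fst`).
* §1 the identity site kernel as a LEG: `toF_idK1` (`toF idK1 = kdeltaF`), **`periodiseF_toF_idK1`** (`(idK1)^ = 1` on every torus), `decays_idK1`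
  (`Decays idK1 1 δ` for EVERY rate `δ`), `idK1_imageShift` (translation invariance), `comp_idK1_left`, `comp_idK1_right`, **`hessKer_idK1`**
  (`hessKer idK1 𝒱 𝒲 μ ν z = ½·(tr (𝒲 μ 0 ν z) − tr (𝒱 μ 0 ∘ 𝒱 ν z))` — a plain trace of `ℤ⁴` arrays, no resolvent).
* §2 **`tendsto_hessT_Gtau`** — the «COMB-FP LEG» socket of `KCombineCov` §4 under its reserved name, AT `Gτ := idK1`: for bi-localised scalar word
  families `𝒳τ`, `𝒳τ₂`, `hessT ((idK1)^; (arr 𝒳τ•)^) → hessKer idK1 𝒳τ 𝒳τ₂ μ ν z` (TA3 at the identity leg), and `hessT_idK1_hat` (the torus functional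
  IS the plain trace word `½·(tr Y − tr (X·X′))`, `KCombineCov.hessT_one_leg`).
* §3 the junction on the torus: `hessT_one_cycle` (trace cyclicity `ρ ↝ σ` for the identity leg: `hessT 1 (τ·(X•·N)) = hessT 1 ((N·τ)·X•)`),
  `one_submatrix_unit`, **`hessT_combFP_What0_eq_idK1`** — THE «COMB-FP» FUNCTIONAL `eτ` OF `KCombineCov.identity_array_currency_cov_What0` IN FIBRED
  SITE CURRENCY: for gauge jets `W• = M•·N̂` (letters), `hessT (1; τ_T·Wₛ, τ_T·Wₜ, τ_T·Wₛₜ) = hessT ((idK1)^; ((N̂τ_T)·Mₛ)ᶠ, ((N̂τ_T)·Mₜ)ᶠ, ((N̂τ_T)·Mₛₜ)ᶠ)`,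
  `N̂·τ_T = N̂F.submatrix id e₁` (`Nhat_mul_tauT`: the periodised comb gauge functions) — what remains for the dictionary letter `heτ` is the ARRAY
  reading of the three site words `(N̂F.submatrix id e₁)·M•` ((A2-τ), not here).
* §4 **`hessKer_transfer_road_cov_Cgh_idK1`** — `KCombineCov.hessKer_transfer_road_cov` with BOTH new leg sockets DISCHARGED (`GΦ := Cgh (m+1) a` by
  `KCombineCovLegs.tendsto_hessT_GPhi`, `Gτ := idK1` by §2): the `ℤ⁴` identity of slot (K)'s covariant organisation
  `hessKer G_M 𝒱M 𝒲M + hessKer (Cgh (m+1) a) 𝒳Φ 𝒳Φ₂ = hessKer (NlegRoad m a) 𝒱N 𝒲N + 2·hessKer idK1 𝒳τ 𝒳τ₂` holds modulo EXACTLY the per-torus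
  identity `hId` in array currency, the BiLoc letters of the six word families and `Spr (Ga (m+1) a)` — i.e. modulo the TABLE DICTIONARY (A2) alone.
WHAT IT IS NOT: not the array reading of the site words ((A2-Φ)∕(A2-τ)), not WARD-L, not the END.
Unit `b2b-balaban-beta-d1-formalise-leaf-03` (gen 11), claim «(A1′-τ)» (journal, after l.28365); road owner `b2b-balaban-beta-d1-p2`.
-/

noncomputable section

namespace Summit.QuantumFields.BalabanUV.Beta.D1BFx.KCombineCovCombLeg

open Matrix Filter Topology
open scoped BigOperators
open Literature.MathematicalPhysics.QuantumFieldTheory.Balaban1983to89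
open Literature.MathematicalPhysics.QuantumFieldTheory.Balaban1983to89.Beta
open ExpKernelCalculus (MKer Decays BiLoc hessKer shiftK comp tr tadpole bubble)
open B12Sec2to5 (l1 l1_nonneg)
open AffineAveraging (box toSite)
open OneStepResolventKernel (Fib)
open OneStepKernelFamily (KInvStep)
open Summit.QuantumFields.BalabanUV.Beta.TameKernelCalculus (Spr)
open Summit.QuantumFields.BalabanUV.Beta.AxialDressingRooted (coDressKBmAt)
open Summit.QuantumFields.BalabanUV.Beta.D1BFx.FibredPeriodisation (periodiseF kdeltaF periodiseF_kdeltaF_matrix)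
open Summit.QuantumFields.BalabanUV.Beta.D1BFx.SortedKernels (blocksHat)
open Summit.QuantumFields.BalabanUV.Beta.D1BFx.SortedPack (sortK)
open Summit.QuantumFields.BalabanUV.Beta.D1BFx.SortedEmbedding (e₁)
open Summit.QuantumFields.BalabanUV.Beta.D1BFx.PeriodicArrays (arr toF toF_apply)
open Summit.QuantumFields.BalabanUV.Beta.D1BFx.MixedVarPackedHess (hessT)
open Summit.QuantumFields.BalabanUV.Beta.D1BFx.TorusCombKKT (I J CombRows tauT Khat Qhat)
open Summit.QuantumFields.BalabanUV.Beta.D1BFx.TorusGaugeBasisMatrix (Nhat NhatF)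
open Summit.QuantumFields.BalabanUV.Beta.D1BFx.TorusGaugeBasisKernel (Nhat_mul_tauT)
open Summit.QuantumFields.BalabanUV.Beta.D1BFx.RWeightedLegPack (NlegRoad)
open Summit.QuantumFields.BalabanUV.Beta.D1BFx.GaugeJetLocal (idK1 idK1_apply)
open Summit.QuantumFields.BalabanUV.Beta.D1BFx.TorusTraceTadpole (tendsto_hessT_hessKer)
open Summit.QuantumFields.BalabanUV.Beta.D1BFx.TorusGhostLegs (tendsto_mul_period)
open Summit.QuantumFields.BalabanUV.Beta.D1BFx.KGhostLeg (Cgh)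
open Summit.QuantumFields.BalabanUV.Beta.D1BFx.KCombineCov (hessT_one_leg hessKer_transfer_road_cov)
open Summit.QuantumFields.BalabanUV.Beta.D1BFx.KCombineCovLegs (hessT_submatrix_fst tendsto_hessT_GPhi)

/-! ## §1 The identity site kernel `idK1` as a leg -/

section Leg

/-- [folklore] The `FKer` reading of `idK1` is the fibred Kronecker kernel. -/
theorem toF_idK1 : toF idK1 = kdeltaF (d := 4) (α := Unit) := by
  funext i j
  obtain ⟨x, a⟩ := i
  obtain ⟨y, b⟩ := j
  simp only [toF_apply, idK1_apply, kdeltaF, Prod.mk.injEq, and_true]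

/-- [folklore] **`(idK1)^ = 1`** on every fine torus (`FibredPeriodisation.periodiseF_kdeltaF_matrix`). -/
theorem periodiseF_toF_idK1 (s : ℕ) [NeZero s] :
    Matrix.of (periodiseF s (toF idK1)) = (1 : Matrix (Site 4 s × Unit) (Site 4 s × Unit) ℝ) := by
  rw [toF_idK1, periodiseF_kdeltaF_matrix]

/-- [folklore] `idK1` decays at EVERY rate with constant `1`. -/
theorem decays_idK1 (δ : ℝ) : Decays idK1 1 δ := by
  intro x y a b
  rw [idK1_apply]
  split_ifs with h
  · subst h; simp [l1]
  · rw [abs_zero, one_mul]; exact (Real.exp_pos _).le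

/-- [folklore] `idK1` is translation invariant, in particular jointly `s`-periodic for every `s`. -/
theorem idK1_imageShift (s : ℕ) (x y t : Fin 4 → ℤ) (a b : Unit) : idK1 (imageShift s x t) (imageShift s y t) a b = idK1 x y a b := by
  simp only [idK1_apply]
  congr 1
  refine propext ⟨fun h => ?_, fun h => by rw [h]⟩
  funext i
  have hi := congrFun h i
  simp only [imageShift] at hi
  linarith

variable (K : MKer 4 Unit)

/-- [folklore] `idK1` is a LEFT identity for `ExpKernelCalculus.comp`. -/
theorem comp_idK1_left : comp idK1 K = K := by
  funext x z a b
  obtain ⟨⟩ := a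
  unfold ExpKernelCalculus.comp
  simp only [Fintype.sum_unique, idK1_apply]
  rw [tsum_eq_single x]
  · rw [if_pos rfl, one_mul]
  · intro y hy; rw [if_neg (Ne.symm hy), zero_mul]

/-- [folklore] `idK1` is a RIGHT identity for `ExpKernelCalculus.comp`. -/
theorem comp_idK1_right : comp K idK1 = K := by
  funext x z a b
  obtain ⟨⟩ := b
  unfold ExpKernelCalculus.comp
  simp only [Fintype.sum_unique, idK1_apply]
  rw [tsum_eq_single z]
  · rw [if_pos rfl, mul_one]
  · intro y hy; rw [if_neg hy, mul_zero]

/-- [folklore] **THE `ℤ⁴` ONE-LOOP FUNCTIONAL AT THE IDENTITY LEG IS A PLAIN TRACE WORD**: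
`hessKer idK1 𝒱 𝒲 μ ν z = ½·(tr (𝒲 μ 0 ν z) − tr (𝒱 μ 0 ∘ 𝒱 ν z))`. -/
theorem hessKer_idK1 (𝒱 : Fin 4 → (Fin 4 → ℤ) → MKer 4 Unit) (𝒲 : Fin 4 → (Fin 4 → ℤ) → Fin 4 → (Fin 4 → ℤ) → MKer 4 Unit)
    (μ ν : Fin 4) (z : Fin 4 → ℤ) :
    hessKer idK1 𝒱 𝒲 μ ν z = (1 / 2) * (tr (𝒲 μ 0 ν z) - tr (comp (𝒱 μ 0) (𝒱 ν z))) := by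
  simp only [hessKer, ExpKernelCalculus.tadpole, ExpKernelCalculus.bubble, comp_idK1_left]
  ring

end Leg

/-! ## §2 The «COMB-FP LEG» socket `tendsto_hessT_Gtau` at `Gτ := idK1` -/

section Socket

variable (m : ℕ)

/-- [folklore] **«COMB-FP LEG» `tendsto_hessT_Gtau`** (the socket name reserved in `KCombineCov` §4) AT `Gτ := idK1`: along the fine tori
`Site 4 ((m+1)·p k)`, `p k → ∞`, for bi-localised scalar word families `𝒳τ` (first jets `𝒳τ μ 0`, `𝒳τ ν z`), `𝒳τ₂` (mixed jet),
`hessT ((idK1)^; (arr (𝒳τ μ 0))^, (arr (𝒳τ ν z))^, (arr (𝒳τ₂ μ 0 ν z))^) → hessKer idK1 𝒳τ 𝒳τ₂ μ ν z` (TA3 `tendsto_hessT_hessKer` at the identity leg). -/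
theorem tendsto_hessT_Gtau (𝒳τ : Fin 4 → (Fin 4 → ℤ) → MKer 4 Unit) (𝒳τ₂ : Fin 4 → (Fin 4 → ℤ) → Fin 4 → (Fin 4 → ℤ) → MKer 4 Unit)
    (μ ν : Fin 4) (z : Fin 4 → ℤ) {P P' Q Q' : Fin 4 → ℤ} {C Cv Cv' δ : ℝ}
    (hV : BiLoc (𝒳τ μ 0) P P' Cv δ) (hV' : BiLoc (𝒳τ ν z) Q' Q Cv' δ) (hW : BiLoc (𝒳τ₂ μ 0 ν z) P Q C δ) (hδ : 0 < δ)
    {p : ℕ → ℕ} [∀ k, NeZero (p k)] (hp : Tendsto p atTop atTop) :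
    Tendsto (fun k => hessT (Matrix.of (periodiseF ((m + 1) * p k) (toF idK1)))
        (Matrix.of (periodiseF ((m + 1) * p k) (toF (arr ((m + 1) * p k) (𝒳τ μ 0)))))
        (Matrix.of (periodiseF ((m + 1) * p k) (toF (arr ((m + 1) * p k) (𝒳τ ν z)))))
        (Matrix.of (periodiseF ((m + 1) * p k) (toF (arr ((m + 1) * p k) (𝒳τ₂ μ 0 ν z)))))) atTop
      (𝓝 (hessKer idK1 𝒳τ 𝒳τ₂ μ ν z)) :=
  tendsto_hessT_hessKer (σ := fun k => (m + 1) * p k) (decays_idK1 1) one_pos (fun _ x y t a b => idK1_imageShift _ x y t a b)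
    𝒳τ 𝒳τ₂ μ ν z hV hV' hW hδ (tendsto_mul_period (m + 1) hp)

/-- [folklore] **THE TORUS FUNCTIONAL AT THE IDENTITY LEG IS THE PLAIN TRACE WORD** `½·(tr Y − tr (X·X′))` (`(idK1)^ = 1`, `KCombineCov.hessT_one_leg`). -/
theorem hessT_idK1_hat (s : ℕ) [NeZero s] (X X' Y : Matrix (Site 4 s × Unit) (Site 4 s × Unit) ℝ) :
    hessT (Matrix.of (periodiseF s (toF idK1))) X X' Y = (1 / 2) * (Y.trace - (X * X').trace) := by
  rw [periodiseF_toF_idK1, hessT_one_leg]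

end Socket

/-! ## §3 The junction on the torus: the «COMB-FP» functional of `KCombineCov` §3′ in fibred site currency -/

section Junction

/-- [folklore] **TRACE CYCLICITY FOR THE IDENTITY LEG**: `hessT (1 : ρ) (τ·(Xₛ·N)) (τ·(Xₜ·N)) (τ·(Xₛₜ·N)) = hessT (1 : σ) ((N·τ)·Xₛ) ((N·τ)·Xₜ) ((N·τ)·Xₛₜ)`
(`τ : ρ × ι`, `X• : ι × σ`, `N : σ × ρ`). -/
theorem hessT_one_cycle {ρ ι σ : Type*} [Fintype ρ] [Fintype ι] [Fintype σ] [DecidableEq ρ] [DecidableEq σ]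
    (τ : Matrix ρ ι ℝ) (N : Matrix σ ρ ℝ) (Xₛ Xₜ Xₛₜ : Matrix ι σ ℝ) :
    hessT (1 : Matrix ρ ρ ℝ) (τ * (Xₛ * N)) (τ * (Xₜ * N)) (τ * (Xₛₜ * N))
      = hessT (1 : Matrix σ σ ℝ) (N * τ * Xₛ) (N * τ * Xₜ) (N * τ * Xₛₜ) := by
  rw [hessT_one_leg, hessT_one_leg]
  have h1 : (τ * (Xₛₜ * N)).trace = (N * τ * Xₛₜ).trace := by
    rw [← Matrix.mul_assoc, Matrix.trace_mul_comm, ← Matrix.mul_assoc]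
  have h2 : (τ * (Xₛ * N) * (τ * (Xₜ * N))).trace = (N * τ * Xₛ * (N * τ * Xₜ)).trace := by
    rw [show τ * (Xₛ * N) * (τ * (Xₜ * N)) = (τ * Xₛ * (N * τ * Xₜ)) * N by simp only [Matrix.mul_assoc], Matrix.trace_mul_comm]
    simp only [Matrix.mul_assoc]
  rw [h1, h2]

/-- [folklore] The identity re-indexed along `Site ≃ Site × Unit` is the identity. -/
theorem one_submatrix_unit (s : ℕ) [NeZero s] :
    (1 : Matrix (Site 4 s × Unit) (Site 4 s × Unit) ℝ).submatrix (fun x => (x, ())) (fun y => (y, ())) = (1 : Matrix (Site 4 s) (Site 4 s) ℝ) := by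
  ext x y
  simp only [Matrix.submatrix_apply, Matrix.one_apply, Prod.mk.injEq, and_true]

variable (m : ℕ) (p : ℕ) [NeZero p] {r : Fin 4 → ℕ}

/-- [folklore] **THE «COMB-FP» FUNCTIONAL `eτ` OF `KCombineCov.identity_array_currency_cov_What0` IN FIBRED SITE CURRENCY.**  At the rooted gauge basis
(comb-FP leg `= 1`), for gauge jets that are column sandwiches of the comb basis, `Wₛ = Mₛ·N̂`, `Wₜ = Mₜ·N̂`, `Wₛₜ = Mₛₜ·N̂` (letters):
`hessT (1; τ_T·Wₛ, τ_T·Wₜ, τ_T·Wₛₜ) = hessT ((idK1)^; ((N̂·τ_T)·Mₛ)ᶠ, ((N̂·τ_T)·Mₜ)ᶠ, ((N̂·τ_T)·Mₛₜ)ᶠ)`, and `N̂·τ_T = N̂F.submatrix id e₁`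
(`TorusGaugeBasisKernel.Nhat_mul_tauT`, the periodised comb gauge functions of all fine bonds) — `r ∈ box 4 (m+1)`. -/
theorem hessT_combFP_What0_eq_idK1 (hr : r ∈ box (3 + 1) (m + 1))
    (Mₛ Mₜ Mₛₜ : Matrix (I 3 (m + 1) p) (Site 4 ((m + 1) * p)) ℝ)
    {Wₛ Wₜ Wₛₜ : Matrix (I 3 (m + 1) p) (CombRows (toSite r) (m + 1) p) ℝ}
    (hWₛ : Wₛ = Mₛ * Nhat r (m + 1) p) (hWₜ : Wₜ = Mₜ * Nhat r (m + 1) p) (hWₛₜ : Wₛₜ = Mₛₜ * Nhat r (m + 1) p) :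
    hessT (1 : Matrix (CombRows (toSite r) (m + 1) p) (CombRows (toSite r) (m + 1) p) ℝ)
        (tauT (toSite r) (m + 1) p * Wₛ) (tauT (toSite r) (m + 1) p * Wₜ) (tauT (toSite r) (m + 1) p * Wₛₜ)
      = hessT (Matrix.of (periodiseF ((m + 1) * p) (toF idK1)))
          (((NhatF r (m + 1) ((m + 1) * p)).submatrix id (e₁ (m + 1) p) * Mₛ).submatrix Prod.fst Prod.fst)
          (((NhatF r (m + 1) ((m + 1) * p)).submatrix id (e₁ (m + 1) p) * Mₜ).submatrix Prod.fst Prod.fst)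
          (((NhatF r (m + 1) ((m + 1) * p)).submatrix id (e₁ (m + 1) p) * Mₛₜ).submatrix Prod.fst Prod.fst) := by
  rw [hWₛ, hWₜ, hWₛₜ, hessT_one_cycle, Nhat_mul_tauT r (m + 1) p hr, periodiseF_toF_idK1, ← one_submatrix_unit ((m + 1) * p),
    hessT_submatrix_fst]

end Junction

/-! ## §4 The `ℤ⁴` identity of `KCombineCov` §4 with BOTH new leg sockets discharged -/

section Combine

variable (m : ℕ) {a : ℝ} {r : Fin 4 → ℕ}

/-- [folklore] **«K-TA4G-COMBINE» WITH BOTH NEW LEG SOCKETS DISCHARGED**: `KCombineCov.hessKer_transfer_road_cov` at `GΦ := Cgh (m+1) a` (socket by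
`KCombineCovLegs.tendsto_hessT_GPhi`) and `Gτ := idK1` (socket by §2 `tendsto_hessT_Gtau`).  Displayed — and nothing else —: `Spr (Ga (m+1) a)`,
`r ∈ box 4 (m+1)`, the BiLoc letters of the six word families, and the per-torus identity `hId` in array currency (= the TABLE DICTIONARY (A2)). -/
theorem hessKer_transfer_road_cov_Cgh_idK1 (ha : 0 < a) (hGa : Spr (GluonLeg.Ga (m + 1) a)) (hr : r ∈ box (3 + 1) (m + 1))
    (𝒱M : Fin 4 → (Fin 4 → ℤ) → MKer 4 (Fib 3)) (𝒲M : Fin 4 → (Fin 4 → ℤ) → Fin 4 → (Fin 4 → ℤ) → MKer 4 (Fib 3))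
    (𝒱N : Fin 4 → (Fin 4 → ℤ) → MKer 4 (Fib 3)) (𝒲N : Fin 4 → (Fin 4 → ℤ) → Fin 4 → (Fin 4 → ℤ) → MKer 4 (Fib 3))
    (𝒳Φ : Fin 4 → (Fin 4 → ℤ) → MKer 4 Unit) (𝒳Φ₂ : Fin 4 → (Fin 4 → ℤ) → Fin 4 → (Fin 4 → ℤ) → MKer 4 Unit)
    (𝒳τ : Fin 4 → (Fin 4 → ℤ) → MKer 4 Unit) (𝒳τ₂ : Fin 4 → (Fin 4 → ℤ) → Fin 4 → (Fin 4 → ℤ) → MKer 4 Unit)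
    (μ ν : Fin 4) (z : Fin 4 → ℤ)
    {PM PM' QM QM' PN PN' QN QN' PΦ PΦ' QΦ QΦ' Pτ Pτ' Qτ Qτ' : Fin 4 → ℤ}
    {CvM CvM' CM δM CvN CvN' CN δN CvΦ CvΦ' CΦ δΦ Cvτ Cvτ' Cτ δτ : ℝ}
    (hVM : BiLoc (𝒱M μ 0) PM PM' CvM δM) (hVM' : BiLoc (𝒱M ν z) QM' QM CvM' δM) (hWM : BiLoc (𝒲M μ 0 ν z) PM QM CM δM) (hδM : 0 < δM)
    (hVN : BiLoc (𝒱N μ 0) PN PN' CvN δN) (hVN' : BiLoc (𝒱N ν z) QN' QN CvN' δN) (hWN : BiLoc (𝒲N μ 0 ν z) PN QN CN δN) (hδN : 0 < δN)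
    (hVΦ : BiLoc (𝒳Φ μ 0) PΦ PΦ' CvΦ δΦ) (hVΦ' : BiLoc (𝒳Φ ν z) QΦ' QΦ CvΦ' δΦ) (hWΦ : BiLoc (𝒳Φ₂ μ 0 ν z) PΦ QΦ CΦ δΦ) (hδΦ : 0 < δΦ)
    (hVτ : BiLoc (𝒳τ μ 0) Pτ Pτ' Cvτ δτ) (hVτ' : BiLoc (𝒳τ ν z) Qτ' Qτ Cvτ' δτ) (hWτ : BiLoc (𝒳τ₂ μ 0 ν z) Pτ Qτ Cτ δτ) (hδτ : 0 < δτ)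
    {p : ℕ → ℕ} [∀ k, NeZero (p k)] (hp : Tendsto p atTop atTop)
    (hId : ∀ k,
      hessT (blocksHat (p k) (sortK (m + 1) (coDressKBmAt (toSite r) (m + 1) (KInvStep (d := 3) (m + 1) 0))))
          (blocksHat (p k) (sortK (m + 1) (arr ((m + 1) * p k) (𝒱M μ 0))))
          (blocksHat (p k) (sortK (m + 1) (arr ((m + 1) * p k) (𝒱M ν z))))
          (blocksHat (p k) (sortK (m + 1) (arr ((m + 1) * p k) (𝒲M μ 0 ν z))))
        + hessT (Matrix.of (periodiseF ((m + 1) * p k) (toF (Cgh (m + 1) a))))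
          (Matrix.of (periodiseF ((m + 1) * p k) (toF (arr ((m + 1) * p k) (𝒳Φ μ 0)))))
          (Matrix.of (periodiseF ((m + 1) * p k) (toF (arr ((m + 1) * p k) (𝒳Φ ν z)))))
          (Matrix.of (periodiseF ((m + 1) * p k) (toF (arr ((m + 1) * p k) (𝒳Φ₂ μ 0 ν z)))))
      = hessT (blocksHat (p k) (sortK (m + 1) (NlegRoad m a)))
          (blocksHat (p k) (sortK (m + 1) (arr ((m + 1) * p k) (𝒱N μ 0))))
          (blocksHat (p k) (sortK (m + 1) (arr ((m + 1) * p k) (𝒱N ν z))))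
          (blocksHat (p k) (sortK (m + 1) (arr ((m + 1) * p k) (𝒲N μ 0 ν z))))
        + 2 * hessT (Matrix.of (periodiseF ((m + 1) * p k) (toF idK1)))
          (Matrix.of (periodiseF ((m + 1) * p k) (toF (arr ((m + 1) * p k) (𝒳τ μ 0)))))
          (Matrix.of (periodiseF ((m + 1) * p k) (toF (arr ((m + 1) * p k) (𝒳τ ν z)))))
          (Matrix.of (periodiseF ((m + 1) * p k) (toF (arr ((m + 1) * p k) (𝒳τ₂ μ 0 ν z)))))) :
    hessKer (coDressKBmAt (toSite r) (m + 1) (KInvStep (d := 3) (m + 1) 0)) 𝒱M 𝒲M μ ν z + hessKer (Cgh (m + 1) a) 𝒳Φ 𝒳Φ₂ μ ν z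
      = hessKer (NlegRoad m a) 𝒱N 𝒲N μ ν z + 2 * hessKer idK1 𝒳τ 𝒳τ₂ μ ν z :=
  hessKer_transfer_road_cov m hGa hr 𝒱M 𝒲M 𝒱N 𝒲N (Cgh (m + 1) a) 𝒳Φ 𝒳Φ₂ idK1 𝒳τ 𝒳τ₂ μ ν z hVM hVM' hWM hδM hVN hVN' hWN hδN hp
    (tendsto_hessT_GPhi m ha 𝒳Φ 𝒳Φ₂ μ ν z hVΦ hVΦ' hWΦ hδΦ hp) (tendsto_hessT_Gtau m 𝒳τ 𝒳τ₂ μ ν z hVτ hVτ' hWτ hδτ hp) hId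

end Combine

end Summit.QuantumFields.BalabanUV.Beta.D1BFx.KCombineCovCombLeg

end
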